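import Literature.AlgebraicGeometry.Frobenioids.ArchimedeanPerfectionUnitTransportVal
import Literature.AlgebraicGeometry.Frobenioids.BiratUnitsTransportInjective
import Literature.AlgebraicGeometry.Frobenioids.Thm36SubReadingsQ
import Literature.AlgebraicGeometry.Frobenioids.FrobeniusTypePrime
import Literature.AlgebraicGeometry.Frobenioids.ArchimedeanIsotropicAnchors
import Literature.AlgebraicGeometry.Frobenioids.ArchimedeanIsotropyPropagation
import Literature.AlgebraicGeometry.Frobenioids.ArchimedeanModelType
import HarnessLib

/-!
# Frobenioids II, Thm. 3.6 (i)/(v) at `Λ = ℚ`: the unit transport along linear arrows of `C^pf` FORCES the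
# index ratio — the un-indexed unit-transport law (`hunit` of `Thm36Sub.istrModel_Q_of_section`) is
# unsatisfiable over a complex object (negative companion of `(T-unit)`)

Mochizuki, *The geometry of Frobenioids II: poly-Frobenioids*, Kyushu J. Math. **62** (2008) 401–460, §3,
Thm. 3.6 (i) p. 36 ("rational function monoid naturally isomorphic to `(Φ^fld)^Λ`") and Thm. 3.6 (v) p. 37
(`O^×(A) ≅ S¹ ⊗_ℤ ℚ` for `Λ = ℚ`, `A` complex) [cite: MochizukiFrdII2008, Thm 3.6 (v) p.37]; [FrdI] Prop. 1.11 (iv)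
p. 36, Prop. 2.2 (ii) p. 45, Prop. 4.4 (ii)/(iv) p. 83 [cite: MochizukiFrdI2008, Prop. 4.4 (iv) p.83].

abc-iut cell, layer L1, row M13-c3 (seat abc-iut-w5-d194; independent second reading of abc-iut-w5-d246's finding
F-w5d246-1, L1-lead ruling R128 (2)).  PROOF-ONLY over landed files.  For a linear arrow
`ψ = [ψ₀] : X = (A, n) → X′ = (A′, n′)` of THE perfection `C^pf` at adapted complex, naively isotropic levels
`(a, b)` (`n·a = n′·b`):
* `level_eq_of_intertwines_unitsPerfEquiv` — if the unit `unitsPerfEquiv X [w]` (value `[w] ⊗ 1`) is intertwined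
  along `ψ` with `unitsPerfEquiv X′ [w′]` (value `[w′] ⊗ 1`) for unit scalars `w = ±-twist of w′` with `w′` of
  INFINITE order, then `a = b`, i.e. `X.idx = X′.idx` (`idx_eq_of_intertwines_unitsPerfEquiv`).  Mechanism: the
  partner of `unitsPerfEquiv X [w] = [rot_z]` (`z = τ_a(w^a)`) along `ψ` is UNIQUE (`ψ^birat` is an epimorphism,
  abc-iut-L6-t8's `BiratUnits.eq_of_intertwines_left`) and is the rotation `[rot_{z′}]`, `z = (Base ψ₀).act z′`
  (abc-iut-w5-d246's `intertwines_rotUnit`), of value `±(a/b)·([w′] ⊗ 1)`; comparing with `[w′] ⊗ 1` in the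
  torsion-free part of `S¹ ⊗_ℤ ℚ` gives `a = b` — transport of units multiplies abc-iut-w4-d074's `unitVal`
  (normalised by the LEVEL only) by `n/n′`.
* `false_of_unitTransportLaw`, **`not_unitTransportLaw_of_isComplex`** — consequently the un-indexed law
  "`∀ ψ linear, ∀ w, ψ ∘ ι(unitsPerfEquiv X [Base(ψ)^* w]) = ι(unitsPerfEquiv X′ [w]) ∘ ψ`" (verbatim the binder
  `hunit` of abc-iut-L1-t6's `Thm36Sub.rationalFunctionMonoidStr_Q_of_section` / `istrModel_Q_of_section`,
  `ArchimedeanPerfectionRationalFunctionMonoidStr.lean`) FAILS as soon as ONE object of `C` is complex: test it on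
  the isomorphism `[(frob₁)⁻¹] : (A′^{(b)}, b) ⥲ (A′, 1)`, `b ≥ 2`.  (Over an all-real `C` the units of `C^pf` are
  trivial and the law holds.)  The indexed law — exponents `X.idx`, `X′.idx` — is abc-iut-w5-d246's
  `intertwines_unitsPerfEquiv_pow` (`ArchimedeanPerfectionUnitTransportVal.lean`).
No definitions; [FrdII] §3 is classical; nothing here bears on [IUTchIII] Cor. 3.12.
-/

noncomputable section

namespace Literature.AlgebraicGeometry.Frobenioids

open CategoryTheory Opposite
open scoped TensorProduct

universe v u

namespace ArchFrd

namespace Thm36Sub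

/-! ### Torsion bookkeeping in `S¹ ⊗_ℤ ℚ` -/

/-- If `[y] ⊗ q = 0` in `S¹ ⊗_ℤ ℚ` with `q ≠ 0`, then `y ∈ S¹` is a root of unity (the kernel of
`M → M ⊗_ℤ ℚ` is the torsion of `M`). [cite: MochizukiFrdII2008, Thm 3.6 (v) p.37] -/
theorem exists_pow_eq_one_of_tmul_eq_zero (y : Circle) {q : ℚ} (hq : q ≠ 0)
    (h : (Additive.ofMul y ⊗ₜ[ℤ] q : Additive Circle ⊗[ℤ] ℚ) = 0) :
    ∃ N : ℕ, 0 < N ∧ y ^ N = 1 := by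
  obtain ⟨N, hN⟩ := exists_pnat_smul_eq_zero_of_tmul_eq_zero (Additive.ofMul y) hq h
  refine ⟨N, N.pos, ?_⟩
  have h1 : Additive.ofMul (y ^ (N : ℕ)) = 0 := by
    rw [ofMul_pow, ← natCast_zsmul]
    exact hN
  exact ofMul_eq_zero.mp h1

/-- **The index computation in `S¹ ⊗_ℤ ℚ`**: if `±([y]^a ⊗ b⁻¹) = [y] ⊗ 1` for a point `y ∈ S¹` of infinite
order (the sign `ρ` records a Galois twist), then `a = b` (and the sign is `+`): `[y] ⊗ (±a/b − 1) = 0` forces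
`±a/b = 1` since `[y]` is not torsion. [cite: MochizukiFrdII2008, Thm 3.6 (v) p.37] -/
theorem pnat_eq_of_sign_pow_tmul_eq (y : Circle) (hy : ∀ N : ℕ, 0 < N → y ^ N ≠ 1) (a b : ℕ+) (ρ : Bool)
    (h : (bif ρ then -(Additive.ofMul (y ^ (a : ℕ)) ⊗ₜ[ℤ] (((b : ℕ) : ℚ)⁻¹))
        else Additive.ofMul (y ^ (a : ℕ)) ⊗ₜ[ℤ] (((b : ℕ) : ℚ)⁻¹) : Additive Circle ⊗[ℤ] ℚ) =
      Additive.ofMul y ⊗ₜ[ℤ] (1 : ℚ)) : a = b := by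
  have hb : ((b : ℕ) : ℚ) ≠ 0 := by exact_mod_cast b.ne_zero
  have ha : (0 : ℚ) < ((a : ℕ) : ℚ) := by exact_mod_cast a.pos
  have hb' : (0 : ℚ) < ((b : ℕ) : ℚ) := by exact_mod_cast b.pos
  -- `[y] ⊗ q = [y] ⊗ 1` forces `q = 1`
  have key : ∀ q : ℚ, (Additive.ofMul y ⊗ₜ[ℤ] q : Additive Circle ⊗[ℤ] ℚ) = Additive.ofMul y ⊗ₜ[ℤ] (1 : ℚ) →
      q = 1 := by
    intro q hq'
    by_contra hne
    have h0 : (Additive.ofMul y ⊗ₜ[ℤ] (q - 1) : Additive Circle ⊗[ℤ] ℚ) = 0 := by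
      rw [TensorProduct.tmul_sub, hq', sub_self]
    obtain ⟨N, hN, hyN⟩ := exists_pow_eq_one_of_tmul_eq_zero y (sub_ne_zero.mpr hne) h0
    exact hy N hN hyN
  have hpow : (Additive.ofMul (y ^ (a : ℕ)) ⊗ₜ[ℤ] (((b : ℕ) : ℚ)⁻¹) : Additive Circle ⊗[ℤ] ℚ) =
      Additive.ofMul y ⊗ₜ[ℤ] (((a : ℕ) : ℚ) * ((b : ℕ) : ℚ)⁻¹) := by
    rw [ofMul_pow, ← natCast_zsmul, zsmul_tmul_eq, Int.cast_natCast]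
  cases ρ with
  | false =>
    have h1 : ((a : ℕ) : ℚ) * ((b : ℕ) : ℚ)⁻¹ = 1 := key _ (by rw [← hpow]; exact h)
    rw [mul_inv_eq_one₀ hb] at h1
    exact PNat.coe_inj.mp (by exact_mod_cast h1)
  | true =>
    exfalso
    have h1 : -(((a : ℕ) : ℚ) * ((b : ℕ) : ℚ)⁻¹) = 1 :=
      key _ (by rw [TensorProduct.tmul_neg, ← hpow]; exact h)
    have h2 : (0 : ℚ) < ((a : ℕ) : ℚ) * ((b : ℕ) : ℚ)⁻¹ := mul_pos ha (inv_pos.mpr hb')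
    linarith

/-- A unit scalar of INFINITE order over a complex base: `exp(i) ∈ O_ℂ^× = S¹` (`π` is irrational,
abc-iut-w4-d074's `circleExp_one_pow_ne_one`). [cite: MochizukiFrdII2008, Thm 3.6 (v) p.37] -/
theorem exists_unitScalar_forall_pow_ne_one (K : D0) (hK : K.IsComplex) :
    ∃ w : D0.unitScalars K, ∀ N : ℕ, 0 < N → (w : ℂˣ) ^ N ≠ 1 := by
  have hK' : K = D0.complex := hK
  subst hK'
  have h1 : ‖((Circle.toUnits (Circle.exp 1) : ℂˣ) : ℂ)‖ = 1 := by
    rw [Circle.toUnits_apply, Units.val_mk0]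
    exact (Circle.exp 1).norm_coe
  have hmem : Circle.toUnits (Circle.exp 1) ∈ D0.unitScalars D0.complex :=
    (D0.mem_unitScalars_iff _ _).mpr ⟨by rw [D0.scalars_complex]; exact Subgroup.mem_top _, h1⟩
  refine ⟨⟨Circle.toUnits (Circle.exp 1), hmem⟩, fun N hN hN1 => ?_⟩
  have h' : Circle.toUnits (Circle.exp 1 ^ N) = 1 := by
    rw [map_pow]
    exact hN1
  have h'' := congrArg unitCirc h'
  rw [unitCirc_toUnits, unitCirc_one] at h''
  exact circleExp_one_pow_ne_one N hN h''

section Pf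

variable {D : Type u} [Category.{v} D] {π : D ⥤ D0}

open PreFrobenioid PreFrobenioid.Perfection

variable {hF : PreFrobenioid.IsFrobenioid (C.toElem π)}

/-- **The unit transport along a linear arrow of `C^pf` forces the levels**: for `ψ = [ψ₀]`,
`ψ₀ : A^{(a)} → A′^{(b)}` linear, `n·a = n′·b`, complex naively isotropic levels, and unit scalars `w`, `w′` with
`w = galAct σ w′`, `w′` of infinite order: if `ι(unitsPerfEquiv X [w])` and `ι(unitsPerfEquiv X′ [w′])` are
intertwined along `ψ` in `C^birat` (`ψ ∘ u = u′ ∘ ψ`), then `a = b`.  (The unique partner of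
`unitsPerfEquiv X [w] = [rot_{τ_a(w^a)}]` is `[rot_{z′}]` of value `±(a/b)·[w′] ⊗ 1`, not `[w′] ⊗ 1`, unless
`a = b`: Prop. 1.11 (iv) uniqueness + Thm. 3.6 (v) torsion-freeness.) [cite: MochizukiFrdI2008, Prop. 1.11(iv) p.36] -/
theorem level_eq_of_intertwines_unitsPerfEquiv (X X' : pfCat π hF)
    (hPf : PreFrobenioid.IsFrobenioid (pfStr π hF)) {a b : ℕ+} (e : X.idx * a = X'.idx * b)
    (hc : (frobPow hF X.obj a).fst.IsNaivelyIsotropic) (hc' : (frobPow hF X'.obj b).fst.IsNaivelyIsotropic)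
    (ψ₀ : frobPow hF X.obj a ⟶ frobPow hF X'.obj b) (hψ₀ : C0.degFr ψ₀.fst = 1)
    (hcx : (frobPow hF X.obj a).fst.IsComplexObj) (hcx' : (frobPow hF X'.obj b).fst.IsComplexObj)
    (w : D0.unitScalars (π.obj X.obj.snd)) (w' : D0.unitScalars (π.obj X'.obj.snd)) (σ : Bool)
    (hw : (w : ℂˣ) = D0.galAct σ (w' : ℂˣ)) (hw' : ∀ N : ℕ, 0 < N → (w' : ℂˣ) ^ N ≠ 1)
    (H : BiratUnits.Intertwines hPf (Hom.mk (⟨⟨a, b, e⟩, ψ₀⟩ : Rep X X'))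
      (BiratUnits.unitsToBirat hPf X (unitsPerfEquiv X (Frobenioids.Perfection.of _ w)))
      (BiratUnits.unitsToBirat hPf X' (unitsPerfEquiv X' (Frobenioids.Perfection.of _ w')))) :
    a = b := by
  -- the rotation representing `unitsPerfEquiv X [w]` at level `a`, and its twist to the level `b` of `X′`
  set z : ℂˣ := D0.galAct (levelTwist X a) ((w : ℂˣ) ^ (1 * (a : ℕ))) with hzdef
  set z' : ℂˣ := D0.galAct (D0.Hom.twists (C0.Base ψ₀.fst)) z with hz'def
  have hz : ‖(z : ℂ)‖ = 1 := by
    rw [hzdef, D0.norm_galAct, Units.val_pow_eq_pow_val, norm_pow, w.2.2, one_pow]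
  have hz' : ‖(z' : ℂ)‖ = 1 := by
    rw [hz'def, D0.norm_galAct]
    exact hz
  have ez : z = (C0.Base ψ₀.fst :).act z' := by
    rw [hz'def, D0.Hom.act, D0.galAct_galAct]
  have hu : unitsPerfEquiv X (Frobenioids.Perfection.of _ w) = rotUnit X hc hcx z hz := by
    have h1 := unitsPerfEquiv_of_pow_eq_rotUnit X hc hcx w 1 z hz (by rw [hzdef, D0.galAct_galAct])
    rwa [pow_one] at h1
  rw [hu] at H
  -- uniqueness of the partner along `ψ` (`ψ^birat` is an epimorphism) and faithfulness on units
  have hsq := PreFrobenioid.hasBiratSquares_of_isFrobenioid hPf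
  have E := BiratUnits.eq_of_intertwines_left hsq
    (intertwines_rotUnit X X' hPf e hc hc' ψ₀ hψ₀ hcx hcx' ez hz hz') H
  have E' := BiratUnits.unitsToBirat_injective E
  -- compare the values in `S¹ ⊗_ℤ ℚ`
  have hval := congrArg (unitVal X') E'
  rw [unitVal_rotUnit, Frobenioids.Perfection.of_apply, unitVal_unitsPerfEquiv_mk, PNat.one_coe, Nat.cast_one,
    inv_one] at hval
  have hρ : D0.galAct (levelTwist X' b) z' =
      D0.galAct (xor (xor (xor σ (levelTwist X a)) (D0.Hom.twists (C0.Base ψ₀.fst))) (levelTwist X' b))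
        ((w' : ℂˣ) ^ (a : ℕ)) := by
    rw [hz'def, hzdef, one_mul, hw, ← map_pow, D0.galAct_xor, D0.galAct_xor, D0.galAct_xor]
  have hn : ‖(((w' : ℂˣ) ^ (a : ℕ) : ℂˣ) : ℂ)‖ = 1 := by
    rw [Units.val_pow_eq_pow_val, norm_pow, w'.2.2, one_pow]
  rw [hρ, ofMul_unitCirc_galAct _ hn, unitCirc_pow w'.2.2] at hval
  -- `unitCirc w′ ∈ S¹` has infinite order
  have hy : ∀ N : ℕ, 0 < N → unitCirc (w' : ℂˣ) ^ N ≠ 1 := by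
    intro N hN hN1
    rw [← unitCirc_pow w'.2.2,
      unitCirc_eq_one_iff (by rw [Units.val_pow_eq_pow_val, norm_pow, w'.2.2, one_pow])] at hN1
    exact hw' N hN hN1
  exact pnat_eq_of_sign_pow_tmul_eq _ hy a b _ hval

/-- The same, on the indices: under the hypotheses of `level_eq_of_intertwines_unitsPerfEquiv`,
**`X.idx = X′.idx`** (`n·a = n′·b` and `a = b`). [cite: MochizukiFrdI2008, Prop. 1.11(iv) p.36] -/
theorem idx_eq_of_intertwines_unitsPerfEquiv (X X' : pfCat π hF)
    (hPf : PreFrobenioid.IsFrobenioid (pfStr π hF)) {a b : ℕ+} (e : X.idx * a = X'.idx * b)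
    (hc : (frobPow hF X.obj a).fst.IsNaivelyIsotropic) (hc' : (frobPow hF X'.obj b).fst.IsNaivelyIsotropic)
    (ψ₀ : frobPow hF X.obj a ⟶ frobPow hF X'.obj b) (hψ₀ : C0.degFr ψ₀.fst = 1)
    (hcx : (frobPow hF X.obj a).fst.IsComplexObj) (hcx' : (frobPow hF X'.obj b).fst.IsComplexObj)
    (w : D0.unitScalars (π.obj X.obj.snd)) (w' : D0.unitScalars (π.obj X'.obj.snd)) (σ : Bool)
    (hw : (w : ℂˣ) = D0.galAct σ (w' : ℂˣ)) (hw' : ∀ N : ℕ, 0 < N → (w' : ℂˣ) ^ N ≠ 1)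
    (H : BiratUnits.Intertwines hPf (Hom.mk (⟨⟨a, b, e⟩, ψ₀⟩ : Rep X X'))
      (BiratUnits.unitsToBirat hPf X (unitsPerfEquiv X (Frobenioids.Perfection.of _ w)))
      (BiratUnits.unitsToBirat hPf X' (unitsPerfEquiv X' (Frobenioids.Perfection.of _ w')))) :
    X.idx = X'.idx := by
  have hab := level_eq_of_intertwines_unitsPerfEquiv X X' hPf e hc hc' ψ₀ hψ₀ hcx hcx' w w' σ hw hw' H
  subst hab
  exact mul_right_cancel e

variable (hF)

/-- **The un-indexed unit-transport law fails at `[(frob₁)⁻¹] : (A′^{(b)}, n′·b) ⥲ (A′, n′)`**: for `A′`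
complex, `b ≠ 1` a naively isotropic level of `A′`, the law "`∀ ψ linear, ∀ w`: `ι(unitsPerfEquiv X [Base(ψ)^*w])`
and `ι(unitsPerfEquiv X′ [w])` are intertwined along `ψ`" (the binder `hunit` of
`Thm36Sub.istrModel_Q_of_section`) is contradictory. [cite: MochizukiFrdII2008, Thm 3.6 (v) p.37] -/
theorem false_of_unitTransportLaw (X' : pfCat π hF) (hX' : (π.obj X'.obj.snd).IsComplex) {b : ℕ+}
    (hb : b ≠ 1) (hc' : (frobPow hF X'.obj b).fst.IsNaivelyIsotropic)
    (hunit : ∀ ⦃X X' : pfCat π hF⦄ (ψ : X ⟶ X'), IsLinear (pfStr π hF) ψ →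
      ∀ w : D0.unitScalars (π.obj X'.obj.snd),
        BiratUnits.Intertwines (pf_isFrobenioid π hF) ψ
          (BiratUnits.unitsToBirat (pf_isFrobenioid π hF) X
            (unitsPerfEquiv X (Frobenioids.Perfection.of _ (D0.unitPull (π.map (Base (pfStr π hF) ψ)) w))))
          (BiratUnits.unitsToBirat (pf_isFrobenioid π hF) X'
            (unitsPerfEquiv X' (Frobenioids.Perfection.of _ w)))) :
    False := by
  -- the source `X = (A′^{(b)}, n′·b)` at level `(1, b)`; `ψ₀` = the inverse of the degree-one Frobenius arrow
  let X : pfCat π hF := ⟨frobPow hF X'.obj b, X'.idx * b⟩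
  have e : X.idx * 1 = X'.idx * b := mul_one _
  haveI : IsIso (frob hF X.obj 1) :=
    isIso_of_isFrobeniusType_of_degFr_eq_one hF (isFrobeniusType_frob hF X.obj 1) (degFr_frob hF X.obj 1)
  let ψ₀ : frobPow hF X.obj 1 ⟶ frobPow hF X'.obj b := inv (frob hF X.obj 1)
  have hψ₀ : C0.degFr ψ₀.fst = 1 := ArchFrd.degFr_eq_one_of_isIso π ψ₀
  have hc : (frobPow hF X.obj 1).fst.IsNaivelyIsotropic :=
    C0.isNaivelyIsotropic_of_hom (frob hF X.obj 1).fst hc'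
  have hXc : (π.obj X.obj.snd).IsComplex := isComplex_frobPow X' hX' b
  have hcx : (frobPow hF X.obj 1).fst.IsComplexObj := isComplexObj_frobPow X hXc 1
  have hcx' : (frobPow hF X'.obj b).fst.IsComplexObj := isComplexObj_frobPow X' hX' b
  let ψ : X ⟶ X' := Hom.mk ⟨⟨1, b, e⟩, ψ₀⟩
  have hψ : IsLinear (pfStr π hF) ψ := PreFrobenioid.isLinear_of_isIso (C.toElem π) ψ₀
  obtain ⟨w', hw'⟩ := exists_unitScalar_forall_pow_ne_one (π.obj X'.obj.snd) hX'
  have H := hunit ψ hψ w'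
  have hab := level_eq_of_intertwines_unitsPerfEquiv X X' (pf_isFrobenioid π hF) e hc hc' ψ₀ hψ₀ hcx hcx'
    (D0.unitPull (π.map (Base (pfStr π hF) ψ)) w') w' (D0.Hom.twists (π.map (Base (pfStr π hF) ψ)))
    (D0.coe_unitPull _ _) hw' H
  exact hb hab.symm

/-- **The un-indexed unit-transport law (`hunit` of `Thm36Sub.istrModel_Q_of_section` /
`rationalFunctionMonoidStr_Q_of_section`) is UNSATISFIABLE as soon as `C` has a complex object** `A′`:
transport of units along linear arrows of `C^pf` multiplies the level-normalised value `unitVal` by the index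
ratio `n/n′` (abc-iut-w5-d246's finding; the indexed law is `intertwines_unitsPerfEquiv_pow`).  Over an all-real
`C` the units of `C^pf` are trivial (`unitsSubgroup_eq_bot_of_isReal`) and the law holds vacuously.
[cite: MochizukiFrdII2008, Thm 3.6 (i) p.36] -/
theorem not_unitTransportLaw_of_isComplex (A' : C π) (hA' : (π.obj A'.snd).IsComplex) :
    ¬ ∀ ⦃X X' : pfCat π hF⦄ (ψ : X ⟶ X'), IsLinear (pfStr π hF) ψ →
      ∀ w : D0.unitScalars (π.obj X'.obj.snd),
        BiratUnits.Intertwines (pf_isFrobenioid π hF) ψ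
          (BiratUnits.unitsToBirat (pf_isFrobenioid π hF) X
            (unitsPerfEquiv X (Frobenioids.Perfection.of _ (D0.unitPull (π.map (Base (pfStr π hF) ψ)) w))))
          (BiratUnits.unitsToBirat (pf_isFrobenioid π hF) X'
            (unitsPerfEquiv X' (Frobenioids.Perfection.of _ w))) := by
  intro hunit
  let X' : pfCat π hF := ⟨A', 1⟩
  obtain ⟨n₀, hn₀⟩ := exists_isotropic_levels X'
  have hb : n₀ * 2 ≠ 1 := fun h => by
    have h1 := congrArg PNat.val h
    simp only [PNat.mul_coe, PNat.val_ofNat] at h1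
    omega
  exact false_of_unitTransportLaw hF X' hA' hb (hn₀ _ (dvd_mul_right n₀ 2)) hunit

end Pf

end Thm36Sub

end ArchFrd

end Literature.AlgebraicGeometry.Frobenioids

end
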